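import Summits.ResolutionOfSingularities.ResolutionOfSingularities.Theorems.DescentDescentPerfectToAllLevelResolution
import Summits.ResolutionOfSingularities.ResolutionOfSingularities.Theorems.WeightedInvariantDescentPerfectToAllPerfectBaseResolution
import Mathlib.RingTheory.EssentialFiniteness

/-!
# `DescentPerfectToAll` (stmt-ResolutionOfSingularities-0549): the essentially-finite-type level

Route `ResolutionOfSingularities/WeightedInvariant` (shared crux `DescentPerfectToAll`, also Descent /
UniformComplexity), line `root-of-a-constant`, lead c5. A `--supports` helper: the provable sub-case of the crux
singled out by the standing disproof file (§6 `PerfectToFinitelyGenerated`), in its natural generality.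

**Statement.** Fix a prime `p` and assume resolution of singularities for every reduced separated scheme of finite
type over every PERFECT field of characteristic `p`. Let `k₀` be a perfect field, `k` a field of characteristic `p`
which is essentially of finite type over `k₀` (a finitely generated field extension: `Algebra.EssFiniteType k₀ k`),
and `f : X → Spec k` separated, locally of finite type and quasi-compact with `X` reduced. Then `X` admits a
resolution of singularities.

The tree's `stub_levelResolution` is the case `k₀ = 𝔽_p`, `k = closure t` finitely generated over the prime field;
here the perfect base is arbitrary (e.g. `k = 𝔽_p(t^{1/p^∞})(x, y)`, of p-rank 2 but transcendence degree 3 over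
`𝔽_p`, which no finitely generated subfield exhausts separably).

**Proof** (EGA IV₃ 8.8.2 spreading out + generic fibre; no base change of a regular scheme along a field extension).
1. `exists_finiteTypeModel`: a closed `k`-immersion `X ↪ Y₀ ×_{A₀} Spec k`, `A₀ → k` finitely generated over `ℤ`,
   `Y₀ → Spec A₀` separated of finite type; with `Y₀ ×_{A₀} Spec k = lim_{t'} Y₀ ×_{A₀} Spec A₀[t']` over the finite
   `t' ⊇ σ` (`σ` a finite set with `k = Frac k₀[σ]`), the closed subscheme `X` is the base change of its
   scheme-theoretic image `X_R ↪ Y₀ ×_{A₀} Spec R`, `R = A₀[t']` (`exists_isPullback_toImage_of_isLocallyNoetherian`).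
2. Enlarge the base to the finitely generated `k₀`-subalgebra `R' = k₀[φ(G) ∪ t'] ⊇ R` of `k` (`G` generators of
   `A₀`): `V = X_R ×_R Spec R'` is separated of finite type over `R'`, hence over the perfect field `k₀`, and
   `X ≅ V ×_{R'} Spec k` (pasting).
3. The hypothesis resolves the reduction `V_red` (`hasResolution_nilradical_subscheme`); `k = Frac R'`, so
   `Spec k → Spec R'` is a flat preimmersion and the generic fibre of that resolution resolves `V_red ×_{R'} Spec k`
   (`hasResolution_pullback_of_flat_of_surjectiveOnStalks`); finally `V_red ×_{R'} Spec k → V ×_{R'} Spec k ≅ X` is a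
   surjective closed immersion onto a reduced scheme, i.e. an isomorphism.
-/

noncomputable section

set_option linter.dupNamespace false -- mandated namespace of this single-conjunct summit

namespace Summit.ResolutionOfSingularities.ResolutionOfSingularities.Theorems

open CategoryTheory CategoryTheory.Limits AlgebraicGeometry MonoidalCategory Opposite TopologicalSpace
open Literature.AlgebraicGeometry.Limits Literature.AlgebraicGeometry.Morphisms
open Literature.AlgebraicGeometry.Resolution
open Literature.AlgebraicGeometry.Motives (SchemeOver specOver)

-- As in `Literature/AlgebraicGeometry/Limits/SubalgebraDiagram.lean` and `ClosedSubschemes.lean`: the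
-- cone legs `c.π.app i` have source `((Functor.const _).obj c.pt).obj i`, definitionally `c.pt`.
set_option backward.isDefEq.respectTransparency false

universe u

/-- **Reduction commutes with a reduced base change**: if `c : X → V` presents the reduced scheme `X` as the
fibre product `V ×_T S` (`T : IsPullback c f g s`), then the fibre product `V_red ×_T S` of the reduction of `V`
also has a resolution as soon as it has one — precisely, a resolution of `pullback (ι_red ≫ g) s` gives one
of `X`, because the comparison map to `pullback g s ≅ X` is a surjective closed immersion onto a reduced scheme,
hence an isomorphism. [folklore] -/
theorem hasResolution_of_hasResolution_pullback_nilradical {X V T S : Scheme.{u}} {c : X ⟶ V}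
    {f : X ⟶ S} {g : V ⟶ T} {s : S ⟶ T} (hT : IsPullback c f g s) [IsReduced X]
    (h : Scheme.HasResolution (pullback (V.nilradical.subschemeι ≫ g) s)) :
    Scheme.HasResolution X := by
  let ι := V.nilradical.subschemeι
  obtain ⟨e, h₁, h₂⟩ :
      ∃ e : pullback (ι ≫ g) s ⟶ pullback g s,
        pullback.fst (ι ≫ g) s ≫ ι = e ≫ pullback.fst g s ∧ e ≫ pullback.snd g s = pullback.snd (ι ≫ g) s :=
    ⟨pullback.lift (pullback.fst _ _ ≫ ι) (pullback.snd _ _) (by rw [Category.assoc, pullback.condition]),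
      (pullback.lift_fst _ _ _).symm, pullback.lift_snd _ _ _⟩
  have big := IsPullback.of_hasPullback (ι ≫ g) s
  rw [← h₂] at big
  have sq : IsPullback (pullback.fst (ι ≫ g) s) e ι (pullback.fst g s) :=
    IsPullback.of_bot big h₁ (IsPullback.of_hasPullback g s)
  haveI : IsClosedImmersion e := MorphismProperty.of_isPullback (P := @IsClosedImmersion) sq inferInstance
  haveI : Surjective e := MorphismProperty.of_isPullback (P := @Surjective) sq inferInstance
  haveI : IsReduced (pullback g s) := isReduced_of_isOpenImmersion hT.isoPullback.inv
  haveI : IsIso e := isIso_of_isClosedImmersion_of_surjective e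
  exact (h.of_iso e).of_iso hT.isoPullback.inv

/-- **Resolution over perfect fields ⇒ resolution over every field essentially of finite type over a perfect
field.** If every reduced separated scheme of finite type over every perfect field of characteristic `p` admits
a resolution of singularities, then so does every reduced separated scheme of finite type over any field `k` of
characteristic `p` which is a finitely generated field extension (`Algebra.EssFiniteType`) of a perfect field `k₀`:
spread `X` out to a model over a finitely generated `k₀`-subalgebra `R' ⊆ k` with `Frac R' = k`, resolve the
reduction of the model over `k₀`, and take the generic fibre. [cite: EGAIV3, Thm. 8.8.2] -/
theorem hasResolution_of_perfectRes_of_essFiniteType : ∀ (p : ℕ) [Fact p.Prime], (∀ (κ : Type) [Field κ] [CharP κ p] [PerfectField κ] (Z : Scheme.{0}) (h : Z ⟶ Spec (.of κ)), IsSeparated h → LocallyOfFiniteType h → QuasiCompact h → IsReduced Z → Scheme.HasResolution Z) → ∀ (k₀ k : Type) [Field k₀] [PerfectField k₀] [Field k] [CharP k p] [Algebra k₀ k], Algebra.EssFiniteType k₀ k → ∀ (X : Scheme.{0}) (f : X ⟶ Spec (.of k)), IsSeparated f → LocallyOfFiniteType f → QuasiCompact f → IsReduced X → Scheme.HasResolution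 X := by
  intro p _ H k₀ k _ _ _ _ _ hess X f hsep hlft hqc hred
  classical
  -- generators: `k = Frac k₀[σ]`
  obtain ⟨σ, hσ⟩ := (Algebra.essFiniteType_iff k₀ k).mp hess
  -- ### Step 1: a closed `k`-immersion into a finite type model over a finitely generated subring
  obtain ⟨A₀, _, φ, Y₀, p₀, j, hNoeth, hfgA, -, hpsep, hplft, hpqc, hj, hjg⟩ :=
    exists_finiteTypeModel f
  letI : Algebra A₀ k := φ.toAlgebra
  haveI := hNoeth
  let P : SchemeOver A₀ := Over.mk p₀
  haveI : IsSeparated P.hom := hpsep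
  haveI : QuasiCompact P.hom := hpqc
  haveI : LocallyOfFiniteType P.hom := hplft
  let jY : X ⟶ (P ⊗ specOver A₀ k).left := j
  haveI : IsClosedImmersion jY := hj
  have hg : jY ≫ pullback.snd P.hom (specOver A₀ k).hom = f := hjg
  -- ### Step 2: the closed subscheme `X` descends to a stage `R = A₀[t'] ⊆ k`, `σ ⊆ t'`
  haveI : IsLocallyNoetherian (SubalgApprox.prodCone A₀ k σ P).pt := by
    haveI : IsLocallyNoetherian (specOver A₀ k).left :=
      inferInstanceAs (IsLocallyNoetherian (Spec (.of k)))
    change IsLocallyNoetherian (pullback P.hom (specOver A₀ k).hom)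
    exact LocallyOfFiniteType.isLocallyNoetherian (pullback.snd P.hom (specOver A₀ k).hom)
  obtain ⟨i, hi⟩ := exists_isPullback_toImage_of_isLocallyNoetherian
    (SubalgApprox.prodDiagram A₀ k σ P) (SubalgApprox.prodCone A₀ k σ P)
    (SubalgApprox.isLimitProdCone A₀ k σ P) jY
  have HX := hi i (𝟙 i)
  let R : Subalgebra A₀ k := SubalgApprox.sub A₀ k i.unop.1
  let π : (P ⊗ specOver A₀ k).left ⟶ (SubalgApprox.prodDiagram A₀ k σ P).obj i :=
    (SubalgApprox.prodCone A₀ k σ P).π.app i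
  have Hleg : IsPullback π (pullback.snd P.hom (specOver A₀ k).hom)
      (pullback.snd P.hom (specOver A₀ R).hom)
      (Spec.map (CommRingCat.ofHom (algebraMap R k))) :=
    SubalgApprox.isPullback_whiskerLeft_left P ((SubalgApprox.baseCone A₀ k σ).π.app i)
  let Xt : Scheme.{0} := (jY ≫ π).image
  let πt : X ⟶ Xt := (jY ≫ π).toImage
  let ft : Xt ⟶ Spec (.of R) := (jY ≫ π).imageι ≫ pullback.snd P.hom (specOver A₀ R).hom
  let s : Spec (.of k) ⟶ Spec (.of R) := Spec.map (CommRingCat.ofHom (algebraMap R k))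
  have Hmain : IsPullback πt f ft s := by
    have h := HX.flip.paste_vert Hleg
    rwa [hg] at h
  haveI : IsSeparated ft := inferInstance
  haveI : LocallyOfFiniteType ft := inferInstance
  haveI : QuasiCompact ft := inferInstance
  -- ### Step 3: enlarge the base to the finitely generated `k₀`-subalgebra `R' = k₀[φ(G) ∪ t'] ⊇ R`
  obtain ⟨G, hG⟩ := hfgA.out
  let S : Finset k := G.image φ ∪ i.unop.1
  let R' : Subalgebra k₀ k := Algebra.adjoin k₀ (↑S : Set k)
  have hφR' : ∀ a : A₀, φ a ∈ R' := by
    intro a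
    have ha : a ∈ Algebra.adjoin ℤ (G : Set A₀) := by rw [hG]; exact Algebra.mem_top
    rw [Algebra.adjoin_int, mem_subalgebraOfSubring] at ha
    have hφa : φ a ∈ (Subring.closure (G : Set A₀)).map φ := Subring.mem_map.mpr ⟨a, ha, rfl⟩
    rw [RingHom.map_closure] at hφa
    refine (Subring.closure_le.mpr ?_ : Subring.closure (φ '' (G : Set A₀)) ≤ R'.toSubring) hφa
    rintro _ ⟨g, hg, rfl⟩
    exact Algebra.subset_adjoin (Finset.mem_coe.2
      (Finset.mem_union_left _ (Finset.mem_image_of_mem φ (Finset.mem_coe.1 hg))))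
  have hRR' : ∀ x : k, x ∈ R → x ∈ R' := by
    intro x hx
    have hle : Subring.closure (Set.range (algebraMap A₀ k) ∪ (↑(i.unop.1) : Set k)) ≤ R'.toSubring :=
      Subring.closure_le.mpr (by
        rintro y (⟨a, rfl⟩ | hy)
        · exact Subalgebra.mem_toSubring.mpr (hφR' a)
        · exact Subalgebra.mem_toSubring.mpr (Algebra.subset_adjoin
            (Finset.mem_coe.2 (Finset.mem_union_right _ (Finset.mem_coe.1 hy)))))
    exact Subalgebra.mem_toSubring.mp (hle (Algebra.mem_adjoin_iff.mp hx))
  have hσR' : ∀ x : k, x ∈ Algebra.adjoin k₀ (↑σ : Set k) → x ∈ R' := fun x hx =>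
    (Algebra.adjoin_mono (fun y hy => Finset.mem_coe.2
      (Finset.mem_union_right _ (i.unop.2 (Finset.mem_coe.1 hy)))) : Algebra.adjoin k₀ (↑σ : Set k) ≤ R') hx
  let ι : R →+* R' := (R.val.toRingHom).codRestrict R' fun x => hRR' x.1 x.2
  have hι : (algebraMap R' k).comp ι = algebraMap R k := RingHom.ext fun _ => rfl
  let g₀ : Spec (.of R') ⟶ Spec (.of R) := Spec.map (CommRingCat.ofHom ι)
  let s' : Spec (.of k) ⟶ Spec (.of R') := Spec.map (CommRingCat.ofHom (algebraMap R' k))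
  have hs' : s' ≫ g₀ = s := by
    rw [← Spec.map_comp, ← CommRingCat.ofHom_comp, hι]
  -- the model `V = X_R ×_R Spec R'` over `R'`, with `X ≅ V ×_{R'} Spec k`
  let V : Scheme.{0} := pullback ft g₀
  let ft' : V ⟶ Spec (.of R') := pullback.snd ft g₀
  have hw : πt ≫ ft = (f ≫ s') ≫ g₀ := by rw [Category.assoc, hs']; exact Hmain.w
  let c : X ⟶ V := pullback.lift πt (f ≫ s') hw
  have hc₁ : c ≫ pullback.fst ft g₀ = πt := pullback.lift_fst _ _ _
  have hc₂ : c ≫ ft' = f ≫ s' := pullback.lift_snd _ _ _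
  have hbig : IsPullback (c ≫ pullback.fst ft g₀) f ft (s' ≫ g₀) := by
    rw [hc₁, hs']; exact Hmain
  have T : IsPullback c f ft' s' := hbig.of_right hc₂ (IsPullback.of_hasPullback ft g₀)
  -- ### Step 4: `R'` is of finite type over the perfect field `k₀`: resolve the reduction `V_red`
  haveI : CharP k₀ p := (algebraMap k₀ k).charP (algebraMap k₀ k).injective p
  let b : Spec (.of R') ⟶ Spec (.of k₀) := Spec.map (CommRingCat.ofHom (algebraMap k₀ R'))
  haveI : LocallyOfFiniteType b := by
    rw [HasRingHomProperty.Spec_iff (P := @LocallyOfFiniteType)]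
    exact RingHom.finiteType_algebraMap.mpr inferInstance
  haveI : IsSeparated (ft' ≫ b) := inferInstance
  haveI : LocallyOfFiniteType (ft' ≫ b) := inferInstance
  haveI : QuasiCompact (ft' ≫ b) := inferInstance
  obtain ⟨Y, πr, hres⟩ := hasResolution_nilradical_subscheme (ft' ≫ b) (H k₀)
  -- ### Step 5: `k = Frac R'`, so `Spec k → Spec R'` is a flat preimmersion
  have hsurj : ∀ z : k, ∃ x y : R', z = algebraMap R' k x / algebraMap R' k y := by
    intro z
    obtain ⟨t, ht, htu, hzt⟩ := hσ z
    refine ⟨⟨z * t, hσR' _ hzt⟩, ⟨t, hσR' _ ht⟩, ?_⟩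
    change z = z * t / t
    rw [mul_div_assoc, div_self htu.ne_zero, mul_one]
  haveI : IsFractionRing R' k := IsFractionRing.of_field R' k hsurj
  haveI : IsPreimmersion s' := IsPreimmersion.of_isLocalization (nonZeroDivisors R')
  haveI : Flat s' := by
    rw [Flat.SpecMap_iff, CommRingCat.hom_ofHom]
    exact RingHom.flat_algebraMap_iff.mpr (IsLocalization.flat k (nonZeroDivisors R'))
  -- ### Step 6: the generic fibre of the resolution of `V_red` resolves `V_red ×_{R'} Spec k`, i.e. `X`
  haveI := hres.isProper
  haveI : IsNoetherian V.nilradical.subscheme :=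
    Scheme.isNoetherian_of_finiteType_over_field (V.nilradical.subschemeι ≫ ft' ≫ b)
  haveI : IsNoetherian Y :=
    Scheme.isNoetherian_of_finiteType_over_field (πr ≫ V.nilradical.subschemeι ≫ ft' ≫ b)
  haveI := hred
  exact hasResolution_of_hasResolution_pullback_nilradical T
    (hasResolution_pullback_of_flat_of_surjectiveOnStalks (V.nilradical.subschemeι ≫ ft') s' πr hres)

end Summit.ResolutionOfSingularities.ResolutionOfSingularities.Theorems

end
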